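import Literature.Analysis.PDE.SymmetricHyperbolicEnergy
import Literature.Analysis.PDE.WordEnergySupBound
import Literature.Analysis.Calculus.JointSmoothnessPartials
import HarnessLib

/-!
# Joint smoothness of classical solutions of linear first-order systems (topic `Analysis/PDE`)

Analytic layer of the energy-method existence theory for linear first-order symmetric hyperbolic
systems (Friedrichs 1954), built to discharge the named fact
`Literature.Geometry.Lorentzian.KerrSchild.waveCauchyProblem`. Friedrichs' method
(`SymmetricHyperbolicExistence.lean`) produces a solution `U : ℝ → ℝⁿ → W` of
`∂ₜU = 𝒫(t)U = Σⱼ Aⱼ(t) ∂ⱼU + B(t)U` that is smooth in space at each time, with every coordinate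
word derivative `∂_vU` jointly continuous in `(t, x)` and differentiable in time with
`∂ₜ∂_vU = ∂_v(𝒫U)` pointwise. This file proves that such a `U` is **jointly `C^∞` in `(t, x)`**
when the coefficients are jointly smooth (`contDiff_uncurry_of_classical`):

* the class `IsTower` of finite sums of fields `(t, x) ↦ c(t, x) · ∂_vU(t, x)` with jointly smooth
  operator coefficients `c` is stable under `∂ₜ` (through the equation and the Leibniz expansion
  `cwd_bilinear`) and under the spatial partial derivatives, and consists of jointly continuous
  fields, smooth in space;
* hence, by induction on `n` with the criterion "`C^{n+1}` from `C^n` partial-derivative fields"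
  (`contDiffOn_succ_of_partial`, Dieudonné (8.12)), every field of the class is jointly `C^n` for
  all `n`.

Everything is proved; no named fact and no `sorry` is introduced.

## References

* K. O. Friedrichs, *Symmetric hyperbolic linear differential equations*, Comm. Pure Appl. Math.
  7 (1954) 345–392, §4 (differentiability of the solution). [Friedrichs1954]
* J. Dieudonné, *Foundations of Modern Analysis*, Academic Press 1960, (8.12).
-/

noncomputable section

open Set Function Filter ContinuousLinearMap
open scoped ContDiff Topology

namespace Literature.Analysis.PDE

open Literature.Analysis.FunctionSpaces Literature.Analysis.Calculus

variable {ι : Type*} [Fintype ι]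
variable {W : Type*} [NormedAddCommGroup W] [InnerProductSpace ℝ W]

/-! ### Spatial word derivatives of jointly smooth fields -/

section Slice

variable {G : Type*} [NormedAddCommGroup G] [NormedSpace ℝ G]

/-- The partial derivative in the `x`-slice is the full derivative on `(0, eᵢ)`. [folklore] -/
theorem fderiv_slice_apply {F : ℝ × EuclideanSpace ℝ ι → G} {p : ℝ × EuclideanSpace ℝ ι}
    (hF : DifferentiableAt ℝ F p) (w : EuclideanSpace ℝ ι) :
    fderiv ℝ (fun y ↦ F (p.1, y)) p.2 w = fderiv ℝ F p (0, w) := by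
  have h1 : HasFDerivAt (fun y : EuclideanSpace ℝ ι ↦ (p.1, y)) (ContinuousLinearMap.inr ℝ ℝ _) p.2 :=
    hasFDerivAt_prodMk_right p.1 p.2
  have h2 : HasFDerivAt (fun y : EuclideanSpace ℝ ι ↦ F (p.1, y))
      ((fderiv ℝ F p).comp (ContinuousLinearMap.inr ℝ ℝ _)) p.2 := hF.hasFDerivAt.comp p.2 h1
  rw [h2.fderiv]
  rfl

/-- The partial derivative in the `t`-slice is the full derivative on `(1, 0)`. [folklore] -/
theorem hasDerivAt_slice {F : ℝ × EuclideanSpace ℝ ι → G} {p : ℝ × EuclideanSpace ℝ ι}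
    (hF : DifferentiableAt ℝ F p) :
    HasDerivAt (fun s ↦ F (s, p.2)) (fderiv ℝ F p (1, 0)) p.1 := by
  have h1 : HasDerivAt (fun s : ℝ ↦ (s, p.2)) ((1 : ℝ), (0 : EuclideanSpace ℝ ι)) p.1 :=
    (hasDerivAt_id p.1).prodMk (hasDerivAt_const p.1 p.2)
  exact hF.hasFDerivAt.comp_hasDerivAt p.1 h1

/-- **Spatial word derivatives of a jointly smooth field are jointly smooth**:
`(t, x) ↦ ∂_v(F(t, ·))(x)` is `C^∞` on `ℝ × ℝⁿ`. [folklore] -/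
theorem contDiff_cwd_slice {F : ℝ × EuclideanSpace ℝ ι → G} (hF : ContDiff ℝ ∞ F) :
    ∀ v : List ι, ContDiff ℝ ∞ fun p : ℝ × EuclideanSpace ℝ ι ↦ cwd v (fun y ↦ F (p.1, y)) p.2
  | [] => hF
  | i :: v => by
    have ih := contDiff_cwd_slice hF v
    have heq : (fun p : ℝ × EuclideanSpace ℝ ι ↦ cwd (i :: v) (fun y ↦ F (p.1, y)) p.2) =
        fun p ↦ fderiv ℝ (fun q : ℝ × EuclideanSpace ℝ ι ↦ cwd v (fun y ↦ F (q.1, y)) q.2) p (0, bv i) := by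
      funext p
      rw [cwd_cons]
      exact fderiv_slice_apply (ih.differentiable (by simp) p) (bv i)
    rw [heq]
    exact (ih.fderiv_right (m := ∞) (by norm_cast)).clm_apply contDiff_const

end Slice

/-! ### The tower class of a classical solution -/

section Tower

variable (U : ℝ → EuclideanSpace ℝ ι → W)

/-- **The tower class** of `U`: finite sums of fields `(t, x) ↦ c(t, x) ∂_vU(t, x)` with jointly
smooth operator coefficients `c : ℝ × ℝⁿ → (W →L W)`. [cite: Friedrichs1954, §4] -/
inductive IsTower : (ℝ → EuclideanSpace ℝ ι → W) → Prop
  | base {c : ℝ × EuclideanSpace ℝ ι → (W →L[ℝ] W)} (hc : ContDiff ℝ ∞ c) (v : List ι) :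
      IsTower fun t x ↦ c (t, x) (cwd v (U t) x)
  | zero : IsTower fun _ _ ↦ 0
  | add {E₁ E₂ : ℝ → EuclideanSpace ℝ ι → W} :
      IsTower E₁ → IsTower E₂ → IsTower fun t x ↦ E₁ t x + E₂ t x

variable {U}

omit [Fintype ι] in
/-- The tower class is closed under list sums. [folklore] -/
theorem IsTower.list_sum [Fintype ι] {l : List (ℝ → EuclideanSpace ℝ ι → W)}
    (hl : ∀ E ∈ l, IsTower U E) : IsTower U fun t x ↦ (l.map fun E ↦ E t x).sum := by
  induction l with
  | nil => simpa using IsTower.zero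
  | cons E l ih =>
    have h1 : IsTower U E := hl E (by simp)
    have h2 := ih fun E' hE' ↦ hl E' (List.mem_cons_of_mem _ hE')
    simpa [List.map_cons, List.sum_cons] using h1.add h2

omit [Fintype ι] in
/-- The tower class is closed under finite sums. [folklore] -/
theorem IsTower.finset_sum [Fintype ι] {κ : Type*} (s : Finset κ) {E : κ → ℝ → EuclideanSpace ℝ ι → W}
    (hE : ∀ k ∈ s, IsTower U (E k)) : IsTower U fun t x ↦ ∑ k ∈ s, E k t x := by
  classical
  induction s using Finset.induction_on with
  | empty => simpa using IsTower.zero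
  | insert a s ha ih =>
    have h1 : IsTower U (E a) := hE a (Finset.mem_insert_self a s)
    have h2 := ih fun k hk ↦ hE k (Finset.mem_insert_of_mem hk)
    simpa [Finset.sum_insert ha] using h1.add h2

variable (hUs : ∀ t, ContDiff ℝ ∞ (U t))
  (hUc : ∀ v : List ι, Continuous fun p : ℝ × EuclideanSpace ℝ ι ↦ cwd v (U p.1) p.2)

include hUc in
/-- Every field of the tower class is jointly continuous. [cite: Friedrichs1954, §4] -/
theorem IsTower.continuous {E : ℝ → EuclideanSpace ℝ ι → W} (hE : IsTower U E) :
    Continuous fun p : ℝ × EuclideanSpace ℝ ι ↦ E p.1 p.2 := by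
  induction hE with
  | base hc v => exact hc.continuous.clm_apply (hUc v)
  | zero => exact continuous_const
  | add _ _ ih₁ ih₂ => exact ih₁.add ih₂

include hUs in
/-- Every field of the tower class is smooth in space. [cite: Friedrichs1954, §4] -/
theorem IsTower.contDiff_slice {E : ℝ → EuclideanSpace ℝ ι → W} (hE : IsTower U E) (t : ℝ) :
    ContDiff ℝ ∞ (E t) := by
  induction hE with
  | base hc v =>
    exact (hc.comp (contDiff_const.prodMk contDiff_id)).clm_apply (contDiff_cwd (hUs t) v)
  | zero => exact contDiff_const
  | add _ _ ih₁ ih₂ => exact ih₁.add ih₂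

include hUs in
/-- **The tower class is stable under spatial partial derivatives**: for `E` in the class and each
`i` there is `E'` in the class with `∂ᵢ(E(t, ·))(x) = E'(t, x)`. [cite: Friedrichs1954, §4] -/
theorem IsTower.fderiv_slice {E : ℝ → EuclideanSpace ℝ ι → W} (hE : IsTower U E) (i : ι) :
    ∃ E' : ℝ → EuclideanSpace ℝ ι → W, IsTower U E' ∧ ∀ t x, fderiv ℝ (E t) x (bv i) = E' t x := by
  induction hE with
  | @base c hc v =>
    refine ⟨fun t x ↦ (fderiv ℝ c (t, x) (0, bv i)) (cwd v (U t) x) + c (t, x) (cwd (i :: v) (U t) x),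
      (IsTower.base ((hc.fderiv_right (m := ∞) (by norm_cast)).clm_apply contDiff_const) v).add
        (IsTower.base hc (i :: v)), fun t x ↦ ?_⟩
    have hcd : DifferentiableAt ℝ (fun y : EuclideanSpace ℝ ι ↦ c (t, y)) x :=
      ((hc.comp (contDiff_const.prodMk contDiff_id)).differentiable (by simp)) x
    have hgd : DifferentiableAt ℝ (cwd v (U t)) x := differentiable_cwd (hUs t) v x
    rw [fderiv_clm_apply hcd hgd]
    simp only [_root_.add_apply, ContinuousLinearMap.coe_comp, Function.comp_apply,
      ContinuousLinearMap.flip_apply]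
    rw [fderiv_slice_apply (p := (t, x)) ((hc.differentiable (by simp)) _) (bv i), cwd_cons, add_comm]
  | zero => exact ⟨fun _ _ ↦ 0, IsTower.zero, fun t x ↦ by simp⟩
  | @add E₁ E₂ h₁ h₂ ih₁ ih₂ =>
    obtain ⟨E₁', h₁', he₁⟩ := ih₁
    obtain ⟨E₂', h₂', he₂⟩ := ih₂
    refine ⟨fun t x ↦ E₁' t x + E₂' t x, h₁'.add h₂', fun t x ↦ ?_⟩
    have hd₁ : DifferentiableAt ℝ (E₁ t) x := ((h₁.contDiff_slice hUs t).differentiable (by simp)) x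
    have hd₂ : DifferentiableAt ℝ (E₂ t) x := ((h₂.contDiff_slice hUs t).differentiable (by simp)) x
    show fderiv ℝ (fun x ↦ E₁ t x + E₂ t x) x (bv i) = E₁' t x + E₂' t x
    rw [show (fun x ↦ E₁ t x + E₂ t x) = E₁ t + E₂ t from rfl, fderiv_add hd₁ hd₂,
      _root_.add_apply, he₁, he₂]

end Tower

/-! ### Stability of the tower class under the time derivative (through the equation) -/

section TimeDeriv

variable {A : ι → ℝ → EuclideanSpace ℝ ι → (W →L[ℝ] W)} {B : ℝ → EuclideanSpace ℝ ι → (W →L[ℝ] W)}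
variable {U : ℝ → EuclideanSpace ℝ ι → W}
variable (hUs : ∀ t, ContDiff ℝ ∞ (U t))
  (hUd : ∀ (v : List ι) (t : ℝ) (x : EuclideanSpace ℝ ι),
    HasDerivAt (fun s ↦ cwd v (U s) x) (cwd v (foOp (fun j ↦ A j t) (B t) (U t)) x) t)
  (hA : ∀ j, ContDiff ℝ ∞ fun p : ℝ × EuclideanSpace ℝ ι ↦ A j p.1 p.2)
  (hB : ContDiff ℝ ∞ fun p : ℝ × EuclideanSpace ℝ ι ↦ B p.1 p.2)

include hUs hA hB in
/-- **The word derivatives of `𝒫(t)U(t)` through the tower class**: for a jointly smooth operator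
coefficient `c` and a word `v`, `(t, x) ↦ c(t, x) ∂_v(𝒫(t)U(t))(x)` belongs to the class (Leibniz
expansion over the splittings of `v`). [cite: Friedrichs1954, §4] -/
theorem isTower_clm_cwd_foOp {c : ℝ × EuclideanSpace ℝ ι → (W →L[ℝ] W)} (hc : ContDiff ℝ ∞ c)
    (v : List ι) :
    IsTower U fun t x ↦ c (t, x) (cwd v (foOp (fun j ↦ A j t) (B t) (U t)) x) := by
  -- the terms of the expansion
  set TA : ι → List ι × List ι → ℝ → EuclideanSpace ℝ ι → W := fun j p t x ↦
    ((c (t, x)).comp (cwd p.1 (fun y ↦ A j t y) x)) (cwd (p.2 ++ [j]) (U t) x) with hTA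
  set TB : List ι × List ι → ℝ → EuclideanSpace ℝ ι → W := fun p t x ↦
    ((c (t, x)).comp (cwd p.1 (fun y ↦ B t y) x)) (cwd p.2 (U t) x) with hTB
  have hTAt : ∀ j p, IsTower U (TA j p) := fun j p ↦
    IsTower.base (hc.clm_comp (contDiff_cwd_slice (hA j) p.1)) (p.2 ++ [j])
  have hTBt : ∀ p, IsTower U (TB p) := fun p ↦
    IsTower.base (hc.clm_comp (contDiff_cwd_slice hB p.1)) p.2
  have hsum : IsTower U fun t x ↦ (∑ j, (((splittings v).map (TA j)).map fun E ↦ E t x).sum) +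
      (((splittings v).map TB).map fun E ↦ E t x).sum := by
    refine (IsTower.finset_sum _ fun j _ ↦ IsTower.list_sum fun E hE ↦ ?_).add
      (IsTower.list_sum fun E hE ↦ ?_)
    · obtain ⟨p, -, rfl⟩ := List.mem_map.1 hE; exact hTAt j p
    · obtain ⟨p, -, rfl⟩ := List.mem_map.1 hE; exact hTBt p
  -- the expansion identity
  have hexp : (fun t x ↦ c (t, x) (cwd v (foOp (fun j ↦ A j t) (B t) (U t)) x)) =
      fun t x ↦ (∑ j, (((splittings v).map (TA j)).map fun E ↦ E t x).sum) +
        (((splittings v).map TB).map fun E ↦ E t x).sum := by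
    funext t x
    have hAs : ∀ j, ContDiff ℝ ∞ (fun y ↦ A j t y) := fun j ↦
      (hA j).comp (contDiff_const.prodMk contDiff_id)
    have hBs : ContDiff ℝ ∞ (fun y ↦ B t y) := hB.comp (contDiff_const.prodMk contDiff_id)
    have hdj : ∀ j, ContDiff ℝ ∞ (cwd [j] (U t)) := fun j ↦ contDiff_cwd (hUs t) [j]
    have hfo : foOp (fun j ↦ A j t) (B t) (U t) = fun x ↦ (∑ j, A j t x (cwd [j] (U t) x)) + B t x (U t x) := by
      funext x; rfl
    have hsmA : ∀ j, ContDiff ℝ ∞ (fun x ↦ A j t x (cwd [j] (U t) x)) := fun j ↦ (hAs j).clm_apply (hdj j)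
    have hsmB : ContDiff ℝ ∞ (fun x ↦ B t x (U t x)) := hBs.clm_apply (hUs t)
    have hsmS : ContDiff ℝ ∞ (fun x ↦ ∑ j, A j t x (cwd [j] (U t) x)) := ContDiff.sum fun j _ ↦ hsmA j
    rw [hfo, cwd_fun_add hsmS hsmB, cwd_finset_sum _ (fun j _ ↦ hsmA j)]
    simp only [map_add, map_sum]
    congr 1
    · refine Finset.sum_congr rfl fun j _ ↦ ?_
      have h1 := cwd_bilinear (applyCLM W) (hAs j) (hdj j) v
      simp only [applyCLM_apply] at h1
      rw [h1]
      simp only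
      rw [map_list_sum, List.map_map, List.map_map]
      congr 1
      refine List.map_congr_left fun p _ ↦ ?_
      simp only [Function.comp_apply, hTA, ContinuousLinearMap.coe_comp, cwd_append]
    · have h1 := cwd_bilinear (applyCLM W) hBs (hUs t) v
      simp only [applyCLM_apply] at h1
      rw [h1]
      simp only
      rw [map_list_sum, List.map_map, List.map_map]
      congr 1
  rw [hexp]
  exact hsum

include hUs hUd hA hB in
/-- **The tower class is stable under the time derivative**: for `E` in the class there is `E'` in
the class with `d/dt E(t, x) = E'(t, x)` (through the equation `∂ₜ∂_vU = ∂_v(𝒫U)`).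
[cite: Friedrichs1954, §4] -/
theorem IsTower.hasDerivAt {E : ℝ → EuclideanSpace ℝ ι → W} (hE : IsTower U E) :
    ∃ E' : ℝ → EuclideanSpace ℝ ι → W, IsTower U E' ∧ ∀ t x, HasDerivAt (fun s ↦ E s x) (E' t x) t := by
  induction hE with
  | @base c hc v =>
    refine ⟨fun t x ↦ (fderiv ℝ c (t, x) (1, 0)) (cwd v (U t) x) +
        c (t, x) (cwd v (foOp (fun j ↦ A j t) (B t) (U t)) x),
      (IsTower.base ((hc.fderiv_right (m := ∞) (by norm_cast)).clm_apply contDiff_const) v).add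
        (isTower_clm_cwd_foOp hUs hA hB hc v), fun t x ↦ ?_⟩
    have h1 : HasDerivAt (fun s ↦ c (s, x)) (fderiv ℝ c (t, x) (1, 0)) t :=
      hasDerivAt_slice (p := (t, x)) ((hc.differentiable (by simp)) _)
    exact h1.clm_apply (hUd v t x)
  | zero => exact ⟨fun _ _ ↦ 0, IsTower.zero, fun t x ↦ hasDerivAt_const t 0⟩
  | @add E₁ E₂ _ _ ih₁ ih₂ =>
    obtain ⟨E₁', h₁', he₁⟩ := ih₁
    obtain ⟨E₂', h₂', he₂⟩ := ih₂
    exact ⟨fun t x ↦ E₁' t x + E₂' t x, h₁'.add h₂', fun t x ↦ (he₁ t x).add (he₂ t x)⟩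

end TimeDeriv

/-! ### Joint smoothness -/

section Joint

variable {A : ι → ℝ → EuclideanSpace ℝ ι → (W →L[ℝ] W)} {B : ℝ → EuclideanSpace ℝ ι → (W →L[ℝ] W)}
variable {U : ℝ → EuclideanSpace ℝ ι → W}
variable (hUs : ∀ t, ContDiff ℝ ∞ (U t))
  (hUc : ∀ v : List ι, Continuous fun p : ℝ × EuclideanSpace ℝ ι ↦ cwd v (U p.1) p.2)
  (hUd : ∀ (v : List ι) (t : ℝ) (x : EuclideanSpace ℝ ι),
    HasDerivAt (fun s ↦ cwd v (U s) x) (cwd v (foOp (fun j ↦ A j t) (B t) (U t)) x) t)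
  (hA : ∀ j, ContDiff ℝ ∞ fun p : ℝ × EuclideanSpace ℝ ι ↦ A j p.1 p.2)
  (hB : ContDiff ℝ ∞ fun p : ℝ × EuclideanSpace ℝ ι ↦ B p.1 p.2)

include hUs hUc hUd hA hB in
/-- **Every field of the tower class is jointly `C^n`**, by induction on `n`: its partial
derivative fields in `t` and in `x` are (built linearly from) fields of the class.
[cite: Friedrichs1954, §4] -/
theorem IsTower.contDiffOn_nat (n : ℕ) {E : ℝ → EuclideanSpace ℝ ι → W} (hE : IsTower U E) :
    ContDiffOn ℝ n (fun p : ℝ × EuclideanSpace ℝ ι ↦ E p.1 p.2) univ := by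
  induction n generalizing E with
  | zero =>
    exact_mod_cast contDiffOn_zero.2 (hE.continuous hUc).continuousOn
  | succ n ih =>
    obtain ⟨Et, hEt, hdt⟩ := hE.hasDerivAt hUs hUd hA hB
    choose Ex hEx hdx using fun i ↦ hE.fderiv_slice hUs i
    -- the partial derivative fields
    set f₁ : ℝ × EuclideanSpace ℝ ι → ℝ →L[ℝ] W := fun p ↦ (1 : ℝ →L[ℝ] ℝ).smulRight (Et p.1 p.2) with hf₁
    set f₂ : ℝ × EuclideanSpace ℝ ι → EuclideanSpace ℝ ι →L[ℝ] W := fun p ↦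
      ∑ i, (EuclideanSpace.proj i : EuclideanSpace ℝ ι →L[ℝ] ℝ).smulRight (Ex i p.1 p.2) with hf₂
    have h₁ : ∀ p ∈ (univ : Set (ℝ × EuclideanSpace ℝ ι)), HasFDerivAt (fun a ↦ E a p.2) (f₁ p) p.1 :=
      fun p _ ↦ (hdt p.1 p.2).hasFDerivAt
    have h₂ : ∀ p ∈ (univ : Set (ℝ × EuclideanSpace ℝ ι)), HasFDerivAt (fun b ↦ E p.1 b) (f₂ p) p.2 := by
      intro p _
      have hd : DifferentiableAt ℝ (E p.1) p.2 := ((hE.contDiff_slice hUs p.1).differentiable (by simp)) p.2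
      have heq : fderiv ℝ (E p.1) p.2 = f₂ p := by
        ext w
        rw [fderiv_apply_eq_sum_coord (E p.1) p.2 w, hf₂]
        simp only [FunLike.coe_sum, Finset.sum_apply, ContinuousLinearMap.smulRight_apply]
        exact Finset.sum_congr rfl fun i _ ↦ by rw [hdx i p.1 p.2]; rfl
      exact heq ▸ hd.hasFDerivAt
    have hc₁ : ContDiffOn ℝ n f₁ univ := ContDiffOn.smulRight contDiffOn_const (ih hEt)
    have hc₂ : ContDiffOn ℝ n f₂ univ :=
      ContDiffOn.sum fun i _ ↦ ContDiffOn.smulRight contDiffOn_const (ih (hEx i))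
    exact contDiffOn_succ_of_partial isOpen_univ h₁ h₂ hc₁ hc₂

include hUs hUc hUd hA hB in
/-- **Joint smoothness of classical solutions of linear first-order systems with jointly smooth
coefficients**: if `U(t)` is smooth in space for every `t`, every coordinate word derivative
`∂_vU` is jointly continuous and satisfies `∂ₜ∂_vU = ∂_v(𝒫U)` pointwise, and the coefficients of
`𝒫(t) = Σⱼ Aⱼ(t)∂ⱼ + B(t)` are jointly `C^∞`, then `(t, x) ↦ U(t, x)` is `C^∞`.
[cite: Friedrichs1954, §4] -/
theorem contDiff_uncurry_of_classical : ContDiff ℝ ∞ fun p : ℝ × EuclideanSpace ℝ ι ↦ U p.1 p.2 := by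
  have hbase : IsTower U fun t x ↦ (ContinuousLinearMap.id ℝ W) (cwd [] (U t) x) :=
    IsTower.base (c := fun _ ↦ ContinuousLinearMap.id ℝ W) contDiff_const []
  have heq : (fun p : ℝ × EuclideanSpace ℝ ι ↦ U p.1 p.2) =
      fun p ↦ (fun t x ↦ (ContinuousLinearMap.id ℝ W) (cwd [] (U t) x)) p.1 p.2 := by
    funext p; simp [cwd_nil]
  rw [heq, contDiff_infty]
  intro n
  exact contDiffOn_univ.1 (hbase.contDiffOn_nat hUs hUc hUd hA hB n)

end Joint

end Literature.Analysis.PDE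

end
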